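import Literature.NumberTheory.Transcendental.EclIsoAutomorphisms
import HarnessLib

/-!
# Isomorphisms of closures prescribed on a strong tuple (Bays–Kirby 2018, Thm 6.9, QM5)

M. Bays, J. Kirby, *Pseudo-exponential maps, variants, and quasiminimality*, Algebra & Number
Theory 12 (2018), proof of Thm 6.9 (QM5a and QM5b): "Since `M` is `𝒞^{fg}`-homogeneous, `θ₁`
extends to an automorphism `θ₂` of `M`" — an isomorphism of finitely generated strong Γ-subfields
(here: a twisted Γ-isomorphism `c ↦ c'` over an isomorphism `g : ecl(b) ≅ ecl(b')` of closed
countable bases, both sides spanning strong subspaces) extends to an isomorphism of the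
exponential-algebraic closures `ecl(b, c) ≅ ecl(b', c')` extending `g`. This is the successor
step of Kirby 2010, Thm 2.1, with the generic starting pair `(a) ↦ (a')` of
`ZilberHomogeneity.eclIso_extension_of_isStronglyExpAlgClosed` replaced by an arbitrary strong
starting tuple; the proof is the same countable back-and-forth through twisted Γ-isomorphisms
(`ZilberHomogeneity.exists_forth_tw`, i.e. the twisted `ℵ₀`-saturation of Bays–Kirby Prop. 11.2
from generic strong Γ-closedness), for algebraically closed, strongly exponentially-algebraically
closed fields with surjective `exp` and the countable closure property.

Main result: `ZilberHomogeneity.exists_isEIsoOn_extend_of_isGammaIsoTw`.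

## References

* M. Bays, J. Kirby, *Pseudo-exponential maps, variants, and quasiminimality*, Algebra & Number
  Theory 12 (2018) 493–549: Thm 6.9 (proof), Prop. 11.2.
* J. Kirby, *On quasiminimal excellent classes*, J. Symbolic Logic 75 (2010): Thm 2.1.
-/

noncomputable section

open Set MvPolynomial

universe u

namespace Literature.NumberTheory.Transcendental

namespace ZilberHomogeneity

open GammaField Literature.ModelTheory.ExponentialFields.ExponentialRing
  Literature.ModelTheory.Quasiminimal

variable {K : Type u} [Field K] [CharZero K] [Literature.ModelTheory.ExponentialFields.ExponentialRing K]

/-! ### The covering relation with a distinguished tuple -/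

/-- **The back-and-forth relation**: the finite tuples `x`, `y` are *covered* by a twisted
Γ-isomorphism `cc ↦ cc'` over `σ` between tuples from `H₁`, `H₂` spanning strong subspaces,
which also covers the distinguished tuples `c ↦ c'`. (The relation `Covered` of
`ZilberFieldQuasiminimalProofs.lean` is the case of a single distinguished pair.)
[cite: Kirby2010QMEC, Thm 2.1 (proof)] [cite: BaysKirby2018ANT, Thm 6.9 (proof)] -/
def CoveredT {K₁ K₂ : Submodule ℚ K} (σ : fieldOf K₁ ≃+* fieldOf K₂) (H₁ H₂ : Submodule ℚ K)
    {k : ℕ} (c c' : Fin k → K) (n : ℕ) (x y : Fin n → K) : Prop :=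
  ∃ (m : ℕ) (cc cc' : Fin m → K), IsGammaIsoTw σ cc cc' ∧
    IsStrong (K₁ ⊔ Submodule.span ℚ (range cc)) ∧ IsStrong (K₂ ⊔ Submodule.span ℚ (range cc')) ∧
    (∀ i, cc i ∈ H₁) ∧ (∀ i, cc' i ∈ H₂) ∧ (∀ j, ∃ i, cc i = c j ∧ cc' i = c' j) ∧
    ∀ j, ∃ i, cc i = x j ∧ cc' i = y j

/-- Symmetry of the covering relation (invert the twisted Γ-isomorphism). [folklore] -/
theorem CoveredT.symm {K₁ K₂ : Submodule ℚ K} {σ : fieldOf K₁ ≃+* fieldOf K₂} {H₁ H₂ : Submodule ℚ K}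
    {k : ℕ} {c c' : Fin k → K} {n : ℕ} {x y : Fin n → K} (h : CoveredT σ H₁ H₂ c c' n x y) :
    CoveredT σ.symm H₂ H₁ c' c n y x := by
  obtain ⟨m, cc, cc', hiso, hs, hs', hcH, hc'H, hdist, hcov⟩ := h
  exact ⟨m, cc', cc, hiso.symm, hs', hs, hc'H, hcH,
    fun j => let ⟨i, hi, hi'⟩ := hdist j; ⟨i, hi', hi⟩,
    fun j => let ⟨i, hi, hi'⟩ := hcov j; ⟨i, hi', hi⟩⟩

/-- Related tuples have the same pattern of equal coordinates. [folklore] -/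
theorem CoveredT.apply_eq_iff {K₁ K₂ : Submodule ℚ K} {σ : fieldOf K₁ ≃+* fieldOf K₂}
    {H₁ H₂ : Submodule ℚ K} {k : ℕ} {c c' : Fin k → K} {n : ℕ} {x y : Fin n → K}
    (h : CoveredT σ H₁ H₂ c c' n x y) (i j : Fin n) : x i = x j ↔ y i = y j := by
  obtain ⟨m, cc, cc', hiso, -, -, -, -, -, hcov⟩ := h
  obtain ⟨p, hp, hp'⟩ := hcov i
  obtain ⟨q, hq, hq'⟩ := hcov j
  rw [← hp, ← hq, ← hp', ← hq']
  exact hiso.apply_eq_iff p q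

/-- **Forth for the covering relation**: a covered pair extends by any point of `H₁` on the left,
with a partner in `H₂` — provided `H₁ ⊆ ecl (K₁ ∪ c)`. [cite: Kirby2010QMEC, Thm 2.1 (proof)] -/
theorem CoveredT.forth [IsAlgClosed K] (hsurj : IsSurjectiveOntoUnits K)
    {K₁ K₂ : Submodule ℚ K} {σ : fieldOf K₁ ≃+* fieldOf K₂} (hσ : IsEBaseIso K₁ K₂ σ)
    (hK₁ : IsGammaClosed K₁) (hG : IsGenericallyStronglyGammaClosedOver K₂)
    {H₁ H₂ : Submodule ℚ K} (hH₁ : IsGammaClosed H₁) (hH₂ : IsGammaClosed H₂)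
    (hKH₁ : K₁ ≤ H₁) (hKH₂ : K₂ ≤ H₂) {k : ℕ} {c c' : Fin k → K}
    (hHc : (H₁ : Set K) ⊆ ecl ((K₁ : Set K) ∪ range c))
    {n : ℕ} {x y : Fin n → K} (h : CoveredT σ H₁ H₂ c c' n x y) {d : K} (hd : d ∈ H₁) :
    ∃ d' ∈ H₂, CoveredT σ H₁ H₂ c c' (n + 1) (Fin.snoc x d) (Fin.snoc y d') := by
  obtain ⟨m, cc, cc', hiso, hs, hs', hcH, hc'H, hdist, hcov⟩ := h
  -- `d` is exponentially algebraic over `K₁ + ℚcc` (which contains `c`)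
  have hsub : (K₁ : Set K) ∪ range c ⊆ ((K₁ ⊔ Submodule.span ℚ (range cc) : Submodule ℚ K) : Set K) := by
    refine union_subset (fun z hz => Submodule.mem_sup_left hz) ?_
    rintro _ ⟨j, rfl⟩
    obtain ⟨i, hi, -⟩ := hdist j
    rw [← hi]
    exact Submodule.mem_sup_right (Submodule.subset_span ⟨i, rfl⟩)
  have hd' : d ∈ ecl ((K₁ ⊔ Submodule.span ℚ (range cc) : Submodule ℚ K) : Set K) :=
    ecl_mono hsub (hHc hd)
  obtain ⟨l, e, e', he0, hγ, hse, hse', heH, he'H⟩ :=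
    exists_forth_tw hsurj hσ hK₁ hG hH₁ hH₂ hKH₁ hKH₂ hiso hs hs' hcH hc'H hd'
  refine ⟨e' 0, he'H 0, m + (l + 1), Fin.append cc e, Fin.append cc' e', hγ, hse, hse', ?_, ?_, ?_, ?_⟩
  · intro i
    refine Fin.addCases (fun j => ?_) (fun j => ?_) i
    · simpa only [Fin.append_left] using hcH j
    · simpa only [Fin.append_right] using heH j
  · intro i
    refine Fin.addCases (fun j => ?_) (fun j => ?_) i
    · simpa only [Fin.append_left] using hc'H j
    · simpa only [Fin.append_right] using he'H j
  · intro j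
    obtain ⟨i, hi, hi'⟩ := hdist j
    exact ⟨Fin.castAdd (l + 1) i, by simp [hi], by simp [hi']⟩
  · intro j
    refine Fin.lastCases ?_ (fun j' => ?_) j
    · exact ⟨Fin.natAdd m 0, by simp [he0], by simp⟩
    · obtain ⟨i, hi, hi'⟩ := hcov j'
      exact ⟨Fin.castAdd (l + 1) i, by simp [hi], by simp [hi']⟩

/-! ### The theorem -/

set_option maxHeartbeats 400000 in
/-- **Isomorphisms of closures prescribed on a strong tuple** (Bays–Kirby 2018, Thm 6.9, proof
of QM5: an isomorphism `θ₁` of finitely generated strong Γ-subfields over an isomorphism of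
closed countable bases extends to the closures; Kirby 2010, Thm 2.1). Let `K` be algebraically
closed, strongly exponentially-algebraically closed, with surjective `exp` and the countable
closure property; let `g : ecl(b) ≅ ecl(b')` be an isomorphism of exponential fields between
closures of finite tuples, `σ` the induced isomorphism of base Γ-fields (`baseEquiv`), and
`c ↦ c'` a Γ-isomorphism over `σ` between tuples spanning, over the bases, strong subspaces.
Then `g ∪ (c ↦ c')` extends to an isomorphism of exponential fields `ecl(b, c) ≅ ecl(b', c')`.
Proof: the countable back-and-forth of `IsZilberField.eclIso_extension_holds` through the
covering relation `CoveredT`, started at `c ↦ c'` instead of a generic pair.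
[cite: BaysKirby2018ANT, Thm 6.9 (proof)] [cite: Kirby2010QMEC, Thm 2.1] -/
theorem exists_isEIsoOn_extend_of_isGammaIsoTw [IsAlgClosed K]
    (hsurj : IsSurjectiveOntoUnits K) (hSEAC : IsStronglyExpAlgClosed K)
    (hccp : HasCountableClosureProperty K)
    {m n : ℕ} {b : Fin m → K} {b' : Fin n → K} {g : K → K}
    (hg : IsEIsoOn g (ecl (range b)) (ecl (range b')))
    {k : ℕ} {c c' : Fin k → K} (hiso : IsGammaIsoTw (baseEquiv hg) c c')
    (hs : IsStrong (Submodule.span ℚ (ecl (range b)) ⊔ Submodule.span ℚ (range c)))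
    (hs' : IsStrong (Submodule.span ℚ (ecl (range b')) ⊔ Submodule.span ℚ (range c'))) :
    ∃ g' : K → K, IsEIsoOn g' (ecl (range b ∪ range c)) (ecl (range b' ∪ range c')) ∧
      Set.EqOn g' g (ecl (range b)) ∧ ∀ i, g' (c i) = c' i := by
  classical
  -- the bases and the closures
  set K₁ : Submodule ℚ K := Submodule.span ℚ (ecl (range b)) with hK₁def
  set K₂ : Submodule ℚ K := Submodule.span ℚ (ecl (range b')) with hK₂def
  set H₁ : Submodule ℚ K := Submodule.span ℚ (ecl (range b ∪ range c)) with hH₁def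
  set H₂ : Submodule ℚ K := Submodule.span ℚ (ecl (range b' ∪ range c')) with hH₂def
  have hK₁ : IsGammaClosed K₁ := isGammaClosed_span_ecl_univ _
  have hK₂ : IsGammaClosed K₂ := isGammaClosed_span_ecl_univ _
  have hH₁ : IsGammaClosed H₁ := isGammaClosed_span_ecl_univ _
  have hH₂ : IsGammaClosed H₂ := isGammaClosed_span_ecl_univ _
  have hG₁ : IsGenericallyStronglyGammaClosedOver K₁ :=
    ZilberGSGC.isGenericallyStronglyGammaClosedOver_of_isStronglyExpAlgClosed hSEAC K₁
  have hG₂ : IsGenericallyStronglyGammaClosedOver K₂ :=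
    ZilberGSGC.isGenericallyStronglyGammaClosedOver_of_isStronglyExpAlgClosed hSEAC K₂
  have hmemK₁ : ∀ {z : K}, z ∈ K₁ ↔ z ∈ ecl (range b) := fun {z} => by
    rw [← SetLike.mem_coe, hK₁def, coe_span_ecl]
  have hmemK₂ : ∀ {z : K}, z ∈ K₂ ↔ z ∈ ecl (range b') := fun {z} => by
    rw [← SetLike.mem_coe, hK₂def, coe_span_ecl]
  have hmemH₁ : ∀ {z : K}, z ∈ H₁ ↔ z ∈ ecl (range b ∪ range c) := fun {z} => by
    rw [← SetLike.mem_coe, hH₁def, coe_span_ecl]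
  have hmemH₂ : ∀ {z : K}, z ∈ H₂ ↔ z ∈ ecl (range b' ∪ range c') := fun {z} => by
    rw [← SetLike.mem_coe, hH₂def, coe_span_ecl]
  have hKH₁ : K₁ ≤ H₁ := fun z hz => hmemH₁.2 (ecl_mono subset_union_left (hmemK₁.1 hz))
  have hKH₂ : K₂ ≤ H₂ := fun z hz => hmemH₂.2 (ecl_mono subset_union_left (hmemK₂.1 hz))
  have hcH₁ : ∀ i, c i ∈ H₁ := fun i => hmemH₁.2 (subset_ecl _ (Or.inr ⟨i, rfl⟩))
  have hcH₂ : ∀ i, c' i ∈ H₂ := fun i => hmemH₂.2 (subset_ecl _ (Or.inr ⟨i, rfl⟩))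
  have hHc₁ : (H₁ : Set K) ⊆ ecl ((K₁ : Set K) ∪ range c) := by
    intro z hz
    rw [SetLike.mem_coe, hmemH₁] at hz
    refine ecl_mono (union_subset_union_left _ fun w hw => ?_) hz
    rw [SetLike.mem_coe, hmemK₁]; exact subset_ecl _ hw
  have hHc₂ : (H₂ : Set K) ⊆ ecl ((K₂ : Set K) ∪ range c') := by
    intro z hz
    rw [SetLike.mem_coe, hmemH₂] at hz
    refine ecl_mono (union_subset_union_left _ fun w hw => ?_) hz
    rw [SetLike.mem_coe, hmemK₂]; exact subset_ecl _ hw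
  -- the base isomorphism
  set σ := baseEquiv hg with hσdef
  have hσ : IsEBaseIso K₁ K₂ σ := isEBaseIso_baseEquiv hg
  -- the starting pair `c ↦ c'`
  have hstart : CoveredT σ H₁ H₂ c c' 0 Fin.elim0 Fin.elim0 :=
    ⟨k, c, c', hiso, hs, hs', hcH₁, hcH₂, fun j => ⟨j, rfl, rfl⟩, fun j => j.elim0⟩
  -- countability
  have hC₁ : ((H₁ : Set K)).Countable :=
    countable_span_ecl hccp ((finite_range b).union (finite_range c)).countable
  have hC₂ : ((H₂ : Set K)).Countable :=
    countable_span_ecl hccp ((finite_range b').union (finite_range c')).countable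
  -- the back-and-forth
  obtain ⟨g', himg, hcov⟩ := exists_map_of_backAndForth (M := K)
    (S := fun n x y => CoveredT σ H₁ H₂ c c' n x y) (C := (H₁ : Set K)) (C' := (H₂ : Set K)) hC₁ hC₂
    hstart (fun n x y h i j => h.apply_eq_iff i j)
    (fun n x y h _ _ d hd => CoveredT.forth hsurj hσ hK₁ hG₂ hH₁ hH₂ hKH₁ hKH₂ hHc₁ h hd)
    (fun n x y h _ _ d hd => by
      obtain ⟨d₀, hd₀, hcov⟩ := CoveredT.forth hsurj hσ.symm hK₂ hG₁ hH₂ hH₁ hKH₂ hKH₁ hHc₂ h.symm hd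
      refine ⟨d₀, hd₀, ?_⟩
      have := hcov.symm
      rwa [RingEquiv.symm_symm] at this)
  -- extracting a covering pair for finitely many points of `H₁`
  have hpair : ∀ {p : ℕ} (τ : Fin p → K), (∀ i, τ i ∈ H₁) →
      ∃ (m' : ℕ) (cc cc' : Fin m' → K), IsGammaIsoTw σ cc cc' ∧ (∀ j, ∃ i, cc i = c j ∧ cc' i = c' j) ∧
        ∀ j, ∃ i, cc i = τ j ∧ cc' i = g' (τ j) := by
    intro p τ hτ
    obtain ⟨n₀, x, y, hS, -, -, ι, hx, hy⟩ := hcov τ hτ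
    obtain ⟨m', cc, cc', hiso', -, -, -, -, hdist, hcv⟩ := hS
    refine ⟨m', cc, cc', hiso', hdist, fun j => ?_⟩
    obtain ⟨i, hi, hi'⟩ := hcv (ι j)
    exact ⟨i, by rw [hi]; exact congrFun hx j, by rw [hi']; exact congrFun hy j⟩
  -- the closures are E-subfields
  have hHadd : ∀ {u v : K}, u ∈ (H₁ : Set K) → v ∈ (H₁ : Set K) → u + v ∈ (H₁ : Set K) := by
    intro u v hu hv
    rw [SetLike.mem_coe, hmemH₁] at hu hv ⊢
    exact Khovanskii.add_mem_ecl hu hv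
  have hHmul : ∀ {u v : K}, u ∈ (H₁ : Set K) → v ∈ (H₁ : Set K) → u * v ∈ (H₁ : Set K) := by
    intro u v hu hv
    rw [SetLike.mem_coe, hmemH₁] at hu hv ⊢
    exact Khovanskii.mul_mem_ecl hu hv
  have hHexp : ∀ {u : K}, u ∈ (H₁ : Set K) → exp u ∈ (H₁ : Set K) := by
    intro u hu
    rw [SetLike.mem_coe, hmemH₁] at hu ⊢
    exact Khovanskii.exp_mem_ecl hu
  -- conclusion
  have hHset₁ : ((H₁ : Set K)) = ecl (range b ∪ range c) := by rw [hH₁def, coe_span_ecl]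
  have hHset₂ : ((H₂ : Set K)) = ecl (range b' ∪ range c') := by rw [hH₂def, coe_span_ecl]
  refine ⟨g', ?_, ?_, ?_⟩
  · rw [← hHset₁, ← hHset₂]
    refine ⟨⟨?_, ?_, ?_⟩, ?_, ?_, ?_⟩
    · intro z hz
      rw [← himg]; exact mem_image_of_mem g' hz
    · intro p hp q hq hpq
      obtain ⟨m', cc, cc', hiso', -, hcv⟩ := hpair ![p, q] (fun i => by fin_cases i <;> assumption)
      obtain ⟨i, hi, hi'⟩ := hcv 0
      obtain ⟨j, hj, hj'⟩ := hcv 1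
      simp only [Matrix.cons_val_zero, Matrix.cons_val_one] at hi hi' hj hj'
      have := (hiso'.apply_eq_iff i j).2 (by rw [hi', hj', hpq])
      rwa [hi, hj] at this
    · rw [← himg]; exact surjOn_image g' _
    · intro u v hu hv
      obtain ⟨m', cc, cc', hiso', -, hcv⟩ := hpair ![u, v, u + v]
        (fun i => by fin_cases i <;> [exact hu; exact hv; exact hHadd hu hv])
      obtain ⟨i, hi, hi'⟩ := hcv 0
      obtain ⟨j, hj, hj'⟩ := hcv 1
      obtain ⟨l, hl, hl'⟩ := hcv 2
      simp only [Matrix.cons_val_zero, Matrix.cons_val_one, Matrix.cons_val_two,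
        Matrix.tail_cons, Matrix.head_cons] at hi hi' hj hj' hl hl'
      have := hiso'.add_eq (i := i) (j := j) (k := l) (by rw [hi, hj, hl])
      rw [hi', hj', hl'] at this
      exact this.symm
    · intro u v hu hv
      obtain ⟨m', cc, cc', hiso', -, hcv⟩ := hpair ![u, v, u * v]
        (fun i => by fin_cases i <;> [exact hu; exact hv; exact hHmul hu hv])
      obtain ⟨i, hi, hi'⟩ := hcv 0
      obtain ⟨j, hj, hj'⟩ := hcv 1
      obtain ⟨l, hl, hl'⟩ := hcv 2
      simp only [Matrix.cons_val_zero, Matrix.cons_val_one, Matrix.cons_val_two,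
        Matrix.tail_cons, Matrix.head_cons] at hi hi' hj hj' hl hl'
      have := hiso'.mul_eq (i := i) (j := j) (k := l) (by rw [hi, hj, hl])
      rw [hi', hj', hl'] at this
      exact this.symm
    · intro u hu
      obtain ⟨m', cc, cc', hiso', -, hcv⟩ := hpair ![u, exp u]
        (fun i => by fin_cases i <;> [exact hu; exact hHexp hu])
      obtain ⟨i, hi, hi'⟩ := hcv 0
      obtain ⟨l, hl, hl'⟩ := hcv 1
      simp only [Matrix.cons_val_zero, Matrix.cons_val_one] at hi hi' hl hl'
      have := hiso'.exp_eq (i := i) (k := l) (by rw [hi, hl])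
      rw [hi', hl'] at this
      exact this.symm
  · -- `g' = g` on `ecl b`
    intro z hz
    have hzK : z ∈ K₁ := hmemK₁.2 hz
    obtain ⟨m', cc, cc', hiso', -, hcv⟩ := hpair ![z] (fun i => by fin_cases i; exact hKH₁ hzK)
    obtain ⟨i, hi, hi'⟩ := hcv 0
    simp only [Matrix.cons_val_zero] at hi hi'
    have hzF : z ∈ fieldOf K₁ := mem_fieldOf_of_mem hzK
    have := hiso'.eq_of_eq_coe (i := i) (k := ⟨z, hzF⟩) hi
    rw [hi'] at this
    rw [this, hσdef, coe_baseEquiv]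
  · -- `g' cⱼ = c'ⱼ`
    intro j
    obtain ⟨m', cc, cc', hiso', hdist, hcv⟩ := hpair ![c j] (fun i => by fin_cases i; exact hcH₁ j)
    obtain ⟨i₀, hi₀, hi₀'⟩ := hdist j
    obtain ⟨i, hi, hi'⟩ := hcv 0
    simp only [Matrix.cons_val_zero] at hi hi'
    have := (hiso'.apply_eq_iff i₀ i).1 (by rw [hi₀, hi])
    rw [hi₀', hi'] at this
    exact this.symm

end ZilberHomogeneity

end Literature.NumberTheory.Transcendental
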